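import Summits.AtomisticToContinuum.FouriersLaw.Theorems.EmbeddedDrudeMourreGreenKuboContinuationMnLocality
import HarnessLib

/-!
# Nevai's locality lemma with diagonal recurrence coefficients (`stub_mnLocalityB`)

Stub `stub_mnLocalityB` of the line `FilterInvariance` of the crux
`EmbeddedDrudeMourre.GreenKuboContinuation` (item stmt-AtomisticToContinuum-12597): the
generalisation of `stub_mnLocality` (the case `b_n = 0`) to a general three-term recurrence
`x p_0 = A_0 p_1 + B_0 p_0`, `x p_{n+1} = A_{n+1} p_{n+2} + B_{n+1} p_{n+1} + A_n p_n` with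
`A_n → 1/2` and `B_n → 0` (the Nevai class `M(0, 1)`), as needed for the general Máté–Nevai
bounded-variation theorem.

Setting: `τ` is a measure on `ℝ` for which every polynomial is integrable and `p : ℕ → ℝ[X]` is
orthonormal in `L²(τ)` with the recurrence above.

* `mnLocB_integral_X_mul`, `mnLocB_tendsto_X_mul`: the recurrence under the integral sign and its
  bulk limit form; compared with the `B = 0` versions (`mnLoc_integral_X_mul`, `mnLoc_tendsto_X_mul`)
  there is one extra term `B_{k+1} ∫ q p_{k+1} p_l dτ`, which tends to `0 · l₃ = 0`.
* `mnLocB_tendsto_chebyshev_entry` (Nevai 1979, *Orthogonal polynomials*, Mem. AMS 213, §4.1):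
  for all `m i j : ℕ`, `∫ T_m p_{n+i} p_{n+j} dτ → ([j = i + m] + [i = j + m]) / 2` as `n → ∞`
  (the bulk matrix entries of `T_m(J₀)` for the free Jacobi matrix `J₀`), by the same two-step
  induction on `m` as in the `B = 0` file; the limit recursion is literally the same
  (`mnLoc_limit_rec`), since the diagonal terms vanish in the limit.
* `stub_mnLocalityB`: for the general Turán forms
  `S_n = p_{n+1}² - ((x - B_{n+1}) / A_n) p_{n+1} p_n + p_n²`,
  `∫ T_m S_n dτ → 1, 0, -1/2, 0, 0, …` (`m = 0, 1, 2, ≥ 3`): expanding `S_n` gives the three matrix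
  entries of the `B = 0` case (same limit, `mnLoc_limit_value`) plus
  `A_n⁻¹ B_{n+1} ∫ T_m p_{n+1} p_n dτ → 2 · 0 · L_m(1, 0) = 0`.

No bounded variation is used; positivity of `A` and the edge relation are hypotheses of the
registered signature but are not needed by the proof. The recurrence-independent helpers
(`mnLoc_integrable_mul₃`, `mnLoc_tendsto_entry_zero`, `mnLoc_limit_rec`, `mnLoc_limit_value`) are
imported from the `B = 0` file, not restated.
-/
noncomputable section

namespace Summit.AtomisticToContinuum.FouriersLaw.Theorems.GreenKuboContinuation.BandLimitedKrylov

open Filter Topology MeasureTheory Set Polynomial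

/-- One step of the general three-term recurrence under the integral sign: for every polynomial
`q`, `∫ (x q) p_{k+1} p_l dτ = A_{k+1} ∫ q p_{k+2} p_l dτ + B_{k+1} ∫ q p_{k+1} p_l dτ + A_k ∫ q p_k p_l dτ`.
[folklore] -/
theorem mnLocB_integral_X_mul (τ : Measure ℝ) (p : ℕ → ℝ[X]) (A B : ℕ → ℝ)
    (hint : ∀ f : ℝ[X], Integrable (fun ω => f.eval ω) τ)
    (hrec : ∀ n, X * p (n + 1) =
      C (A (n + 1)) * p (n + 2) + C (B (n + 1)) * p (n + 1) + C (A n) * p n)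
    (q : ℝ[X]) (k l : ℕ) :
    ∫ ω, (X * q).eval ω * ((p (k + 1)).eval ω * (p l).eval ω) ∂τ =
      A (k + 1) * ∫ ω, q.eval ω * ((p (k + 2)).eval ω * (p l).eval ω) ∂τ +
        B (k + 1) * ∫ ω, q.eval ω * ((p (k + 1)).eval ω * (p l).eval ω) ∂τ +
        A k * ∫ ω, q.eval ω * ((p k).eval ω * (p l).eval ω) ∂τ := by
  have key : ∀ ω, (X * q).eval ω * ((p (k + 1)).eval ω * (p l).eval ω) =
      A (k + 1) * (q.eval ω * ((p (k + 2)).eval ω * (p l).eval ω)) +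
        B (k + 1) * (q.eval ω * ((p (k + 1)).eval ω * (p l).eval ω)) +
        A k * (q.eval ω * ((p k).eval ω * (p l).eval ω)) := by
    intro ω
    have h := congrArg (fun f => f.eval ω) (hrec k)
    simp only [eval_mul, eval_X, eval_add, eval_C] at h ⊢
    have e : ω * q.eval ω * ((p (k + 1)).eval ω * (p l).eval ω) =
        q.eval ω * (ω * (p (k + 1)).eval ω) * (p l).eval ω := by ring
    rw [e, h]
    ring
  have I₁ : Integrable (fun ω => A (k + 1) * (q.eval ω * ((p (k + 2)).eval ω * (p l).eval ω))) τ :=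
    (mnLoc_integrable_mul₃ τ hint _ _ _).const_mul _
  have I₂ : Integrable (fun ω => B (k + 1) * (q.eval ω * ((p (k + 1)).eval ω * (p l).eval ω))) τ :=
    (mnLoc_integrable_mul₃ τ hint _ _ _).const_mul _
  have I₃ : Integrable (fun ω => A k * (q.eval ω * ((p k).eval ω * (p l).eval ω))) τ :=
    (mnLoc_integrable_mul₃ τ hint _ _ _).const_mul _
  have I₁₂ : Integrable (fun ω => A (k + 1) * (q.eval ω * ((p (k + 2)).eval ω * (p l).eval ω)) +
      B (k + 1) * (q.eval ω * ((p (k + 1)).eval ω * (p l).eval ω))) τ := I₁.add I₂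
  simp_rw [key]
  rw [integral_add I₁₂ I₃, integral_add I₁ I₂, integral_const_mul, integral_const_mul,
    integral_const_mul]

/-- Limit version of `mnLocB_integral_X_mul` in the bulk: if `∫ q p_{n+i+2} p_{n+j+1} dτ → l₁`,
`∫ q p_{n+i} p_{n+j+1} dτ → l₂` and `∫ q p_{n+i+1} p_{n+j+1} dτ → l₃`, then
`∫ (x q) p_{n+i} p_{n+j} dτ → (l₁ + l₂) / 2` (shift `n ↦ n + 1`, recurrence, `A_n → 1/2`,
`B_n → 0`, so the diagonal term contributes `0 · l₃`). [folklore] -/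
theorem mnLocB_tendsto_X_mul (τ : Measure ℝ) (p : ℕ → ℝ[X]) (A B : ℕ → ℝ)
    (hint : ∀ f : ℝ[X], Integrable (fun ω => f.eval ω) τ)
    (hA : Tendsto A atTop (𝓝 (1 / 2))) (hB : Tendsto B atTop (𝓝 0))
    (hrec : ∀ n, X * p (n + 1) =
      C (A (n + 1)) * p (n + 2) + C (B (n + 1)) * p (n + 1) + C (A n) * p n)
    (q : ℝ[X]) (i j : ℕ) (l₁ l₂ l₃ : ℝ)
    (h₁ : Tendsto (fun n : ℕ =>
      ∫ ω, q.eval ω * ((p (n + (i + 2))).eval ω * (p (n + (j + 1))).eval ω) ∂τ) atTop (𝓝 l₁))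
    (h₂ : Tendsto (fun n : ℕ =>
      ∫ ω, q.eval ω * ((p (n + i)).eval ω * (p (n + (j + 1))).eval ω) ∂τ) atTop (𝓝 l₂))
    (h₃ : Tendsto (fun n : ℕ =>
      ∫ ω, q.eval ω * ((p (n + (i + 1))).eval ω * (p (n + (j + 1))).eval ω) ∂τ) atTop (𝓝 l₃)) :
    Tendsto (fun n : ℕ => ∫ ω, (X * q).eval ω * ((p (n + i)).eval ω * (p (n + j)).eval ω) ∂τ)
      atTop (𝓝 ((l₁ + l₂) / 2)) := by
  rw [← tendsto_add_atTop_iff_nat 1]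
  have hAi : Tendsto (fun n => A (n + i)) atTop (𝓝 (1 / 2)) := (tendsto_add_atTop_iff_nat i).2 hA
  have hAi1 : Tendsto (fun n => A (n + i + 1)) atTop (𝓝 (1 / 2)) :=
    (tendsto_add_atTop_iff_nat (i + 1)).2 hA
  have hBi1 : Tendsto (fun n => B (n + i + 1)) atTop (𝓝 0) :=
    (tendsto_add_atTop_iff_nat (i + 1)).2 hB
  have e : (fun n : ℕ =>
      ∫ ω, (X * q).eval ω * ((p (n + 1 + i)).eval ω * (p (n + 1 + j)).eval ω) ∂τ) = fun n : ℕ =>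
      A (n + i + 1) * ∫ ω, q.eval ω * ((p (n + (i + 2))).eval ω * (p (n + (j + 1))).eval ω) ∂τ +
        B (n + i + 1) *
          ∫ ω, q.eval ω * ((p (n + (i + 1))).eval ω * (p (n + (j + 1))).eval ω) ∂τ +
        A (n + i) * ∫ ω, q.eval ω * ((p (n + i)).eval ω * (p (n + (j + 1))).eval ω) ∂τ := by
    funext n
    rw [Nat.add_right_comm n 1 i, Nat.add_right_comm n 1 j]
    exact mnLocB_integral_X_mul τ p A B hint hrec q (n + i) (n + j + 1)
  rw [e]
  have hl : (l₁ + l₂) / 2 = 1 / 2 * l₁ + 0 * l₃ + 1 / 2 * l₂ := by ring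
  rw [hl]
  exact ((hAi1.mul h₁).add (hBi1.mul h₃)).add (hAi.mul h₂)

/-- **Nevai's locality for Chebyshev test polynomials (bulk matrix entries), class `M(0,1)`.**
If every polynomial is `τ`-integrable, `p` is orthonormal in `L²(τ)` with
`x p_{n+1} = A_{n+1} p_{n+2} + B_{n+1} p_{n+1} + A_n p_n`, `A_n → 1/2` and `B_n → 0`, then for
all `m i j`, `∫ T_m p_{n+i} p_{n+j} dτ → ([j = i + m] + [i = j + m]) / 2` as `n → ∞`.
(Nevai 1979, Mem. AMS 213, §4.1.) [folklore] -/
theorem mnLocB_tendsto_chebyshev_entry (τ : Measure ℝ) (p : ℕ → ℝ[X]) (A B : ℕ → ℝ)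
    (hint : ∀ f : ℝ[X], Integrable (fun ω => f.eval ω) τ)
    (horth : ∀ m n, ∫ ω, (p m).eval ω * (p n).eval ω ∂τ = if m = n then 1 else 0)
    (hA : Tendsto A atTop (𝓝 (1 / 2))) (hB : Tendsto B atTop (𝓝 0))
    (hrec : ∀ n, X * p (n + 1) =
      C (A (n + 1)) * p (n + 2) + C (B (n + 1)) * p (n + 1) + C (A n) * p n)
    (m i j : ℕ) :
    Tendsto (fun n : ℕ =>
      ∫ ω, (Chebyshev.T ℝ m).eval ω * ((p (n + i)).eval ω * (p (n + j)).eval ω) ∂τ)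
      atTop (𝓝 (((if j = i + m then 1 else 0) + (if i = j + m then 1 else 0)) / 2)) := by
  induction m using Nat.twoStepInduction generalizing i j with
  | zero =>
    have h := mnLoc_tendsto_entry_zero τ p horth i j
    convert h using 2
    have e : (j = i) ↔ (i = j) := eq_comm
    simp only [Nat.add_zero, e]
    ring
  | one =>
    have hT : Chebyshev.T ℝ ((1 : ℕ) : ℤ) = X * Chebyshev.T ℝ ((0 : ℕ) : ℤ) := by
      simp only [Nat.cast_one, Chebyshev.T_one, Nat.cast_zero, Chebyshev.T_zero, mul_one]
    rw [hT]
    have h := mnLocB_tendsto_X_mul τ p A B hint hA hB hrec (Chebyshev.T ℝ ((0 : ℕ) : ℤ)) i j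
      _ _ _ (mnLoc_tendsto_entry_zero τ p horth (i + 2) (j + 1))
      (mnLoc_tendsto_entry_zero τ p horth i (j + 1))
      (mnLoc_tendsto_entry_zero τ p horth (i + 1) (j + 1))
    convert h using 2
    have e : (i + 2 = j + 1) ↔ (j = i + 1) := by omega
    simp only [e]
  | more m hm hm1 =>
    have hX := mnLocB_tendsto_X_mul τ p A B hint hA hB hrec (Chebyshev.T ℝ ((m + 1 : ℕ) : ℤ))
      i j _ _ _ (hm1 (i + 2) (j + 1)) (hm1 i (j + 1)) (hm1 (i + 1) (j + 1))
    have hT : Chebyshev.T ℝ ((m + 2 : ℕ) : ℤ) =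
        2 * (X * Chebyshev.T ℝ ((m + 1 : ℕ) : ℤ)) - Chebyshev.T ℝ (m : ℤ) := by
      push_cast
      rw [Chebyshev.T_add_two]
      ring
    have e : (fun n : ℕ =>
        ∫ ω, (Chebyshev.T ℝ ((m + 2 : ℕ) : ℤ)).eval ω *
          ((p (n + i)).eval ω * (p (n + j)).eval ω) ∂τ) = fun n : ℕ =>
        2 * ∫ ω, (X * Chebyshev.T ℝ ((m + 1 : ℕ) : ℤ)).eval ω *
            ((p (n + i)).eval ω * (p (n + j)).eval ω) ∂τ -
          ∫ ω, (Chebyshev.T ℝ (m : ℤ)).eval ω * ((p (n + i)).eval ω * (p (n + j)).eval ω) ∂τ := by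
      funext n
      rw [← integral_const_mul, ← integral_sub ((mnLoc_integrable_mul₃ τ hint _ _ _).const_mul _)
        (mnLoc_integrable_mul₃ τ hint _ _ _)]
      congr 1
      funext ω
      rw [hT]
      simp only [eval_sub, eval_mul, eval_ofNat, eval_X]
      ring
    rw [e]
    have h := (hX.const_mul 2).sub (hm i j)
    convert h using 2
    exact mnLoc_limit_rec m i j

/-- **`stub_mnLocalityB` — Nevai's locality (weak-limit) lemma for the class
`a_n → 1/2, b_n → 0`, tested against Chebyshev polynomials.** If every polynomial is
`τ`-integrable, `p_n` is orthonormal in `L²(τ)` and satisfies `x p_0 = A_0 p_1 + B_0 p_0`,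
`x p_{n+1} = A_{n+1} p_{n+2} + B_{n+1} p_{n+1} + A_n p_n` with `A_n > 0`, `A_n → 1/2`, `B_n → 0`,
then for the Turán forms `S_n = p_{n+1}² - ((x - B_{n+1}) / A_n) p_{n+1} p_n + p_n²` and every `m`,
`∫ T_m S_n dτ → 1, 0, -1/2, 0, 0, …` (`m = 0, 1, 2, ≥ 3`). Proof: expand `S_n`, use
`mnLocB_tendsto_chebyshev_entry` for the two squares and for `∫ T_m p_{n+1} p_n dτ`, and
`mnLocB_tendsto_X_mul` for `∫ (x T_m) p_{n+1} p_n dτ`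
(`((x - B_{n+1}) / A_n) T_m p_{n+1} p_n = A_n⁻¹ (x T_m) p_{n+1} p_n - A_n⁻¹ B_{n+1} T_m p_{n+1} p_n`,
`A_n⁻¹ → 2`, `B_{n+1} → 0`).
(Nevai 1979, *Orthogonal polynomials*, Mem. AMS 213, §4.1; Van Assche LNM 1265 §2.) [folklore] -/
theorem stub_mnLocalityB :
    ∀ (τ : Measure ℝ) (p : ℕ → ℝ[X]) (A B : ℕ → ℝ),
      (∀ f : ℝ[X], Integrable (fun ω => f.eval ω) τ) →
      (∀ m n, ∫ ω, (p m).eval ω * (p n).eval ω ∂τ = if m = n then 1 else 0) →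
      (∀ n, 0 < A n) → Tendsto A atTop (𝓝 (1 / 2)) → Tendsto B atTop (𝓝 0) →
      X * p 0 = C (A 0) * p 1 + C (B 0) * p 0 →
      (∀ n, X * p (n + 1) = C (A (n + 1)) * p (n + 2) + C (B (n + 1)) * p (n + 1) + C (A n) * p n) →
      ∀ m : ℕ,
        Tendsto
          (fun n : ℕ => ∫ ω, (Polynomial.Chebyshev.T ℝ m).eval ω *
            (((p (n + 1)).eval ω) ^ 2 - (ω - B (n + 1)) / A n * (p (n + 1)).eval ω * (p n).eval ω
              + ((p n).eval ω) ^ 2) ∂τ)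
          atTop (𝓝 (if m = 0 then 1 else if m = 2 then -(1 / 2) else 0)) := by
  intro τ p A B hint horth _hApos hA hB _hrec₀ hrec m
  have h11 := mnLocB_tendsto_chebyshev_entry τ p A B hint horth hA hB hrec m 1 1
  have h00 := mnLocB_tendsto_chebyshev_entry τ p A B hint horth hA hB hrec m 0 0
  have h10 := mnLocB_tendsto_chebyshev_entry τ p A B hint horth hA hB hrec m 1 0
  have hJ := mnLocB_tendsto_X_mul τ p A B hint hA hB hrec (Chebyshev.T ℝ m) 1 0 _ _ _
    (mnLocB_tendsto_chebyshev_entry τ p A B hint horth hA hB hrec m 3 1)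
    (mnLocB_tendsto_chebyshev_entry τ p A B hint horth hA hB hrec m 1 1)
    (mnLocB_tendsto_chebyshev_entry τ p A B hint horth hA hB hrec m 2 1)
  simp only [Nat.add_zero] at h00 h10 hJ
  have hAinv : Tendsto (fun n => (A n)⁻¹) atTop (𝓝 2) := by
    have h := hA.inv₀ (by norm_num)
    rw [one_div, inv_inv] at h
    exact h
  have hB1 : Tendsto (fun n => B (n + 1)) atTop (𝓝 0) := (tendsto_add_atTop_iff_nat 1).2 hB
  have hextra : Tendsto (fun n : ℕ => (A n)⁻¹ * B (n + 1) *
      ∫ ω, (Chebyshev.T ℝ m).eval ω * ((p (n + 1)).eval ω * (p n).eval ω) ∂τ) atTop (𝓝 0) := by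
    have h := (hAinv.mul hB1).mul h10
    rw [mul_zero, zero_mul] at h
    exact h
  have key : ∀ n : ℕ, ∫ ω, (Chebyshev.T ℝ m).eval ω *
      (((p (n + 1)).eval ω) ^ 2 - (ω - B (n + 1)) / A n * (p (n + 1)).eval ω * (p n).eval ω
        + ((p n).eval ω) ^ 2) ∂τ =
      ∫ ω, (Chebyshev.T ℝ m).eval ω * ((p (n + 1)).eval ω * (p (n + 1)).eval ω) ∂τ -
        (A n)⁻¹ * ∫ ω, (X * Chebyshev.T ℝ m).eval ω * ((p (n + 1)).eval ω * (p n).eval ω) ∂τ +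
        (A n)⁻¹ * B (n + 1) *
          ∫ ω, (Chebyshev.T ℝ m).eval ω * ((p (n + 1)).eval ω * (p n).eval ω) ∂τ +
        ∫ ω, (Chebyshev.T ℝ m).eval ω * ((p n).eval ω * (p n).eval ω) ∂τ := by
    intro n
    have I₁ : Integrable (fun ω => (Chebyshev.T ℝ m).eval ω *
        ((p (n + 1)).eval ω * (p (n + 1)).eval ω)) τ := mnLoc_integrable_mul₃ τ hint _ _ _
    have I₂ : Integrable (fun ω => (A n)⁻¹ * ((X * Chebyshev.T ℝ m).eval ω *
        ((p (n + 1)).eval ω * (p n).eval ω))) τ := (mnLoc_integrable_mul₃ τ hint _ _ _).const_mul _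
    have I₃ : Integrable (fun ω => (A n)⁻¹ * B (n + 1) * ((Chebyshev.T ℝ m).eval ω *
        ((p (n + 1)).eval ω * (p n).eval ω))) τ := (mnLoc_integrable_mul₃ τ hint _ _ _).const_mul _
    have I₄ : Integrable (fun ω => (Chebyshev.T ℝ m).eval ω *
        ((p n).eval ω * (p n).eval ω)) τ := mnLoc_integrable_mul₃ τ hint _ _ _
    have I₁₂ : Integrable (fun ω => (Chebyshev.T ℝ m).eval ω *
        ((p (n + 1)).eval ω * (p (n + 1)).eval ω) - (A n)⁻¹ * ((X * Chebyshev.T ℝ m).eval ω *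
        ((p (n + 1)).eval ω * (p n).eval ω))) τ := I₁.sub I₂
    have I₁₂₃ : Integrable (fun ω => (Chebyshev.T ℝ m).eval ω *
        ((p (n + 1)).eval ω * (p (n + 1)).eval ω) - (A n)⁻¹ * ((X * Chebyshev.T ℝ m).eval ω *
        ((p (n + 1)).eval ω * (p n).eval ω)) + (A n)⁻¹ * B (n + 1) * ((Chebyshev.T ℝ m).eval ω *
        ((p (n + 1)).eval ω * (p n).eval ω))) τ := I₁₂.add I₃
    rw [← integral_const_mul, ← integral_const_mul, ← integral_sub I₁ I₂, ← integral_add I₁₂ I₃,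
      ← integral_add I₁₂₃ I₄]
    congr 1
    funext ω
    simp only [eval_mul, eval_X]
    ring
  refine Tendsto.congr (fun n => (key n).symm) ?_
  have h := ((h11.sub (hAinv.mul hJ)).add hextra).add h00
  convert h using 2
  rw [add_zero]
  exact mnLoc_limit_value m

end Summit.AtomisticToContinuum.FouriersLaw.Theorems.GreenKuboContinuation.BandLimitedKrylov

end
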